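import Summits.CriticalPhenomena.PercolationContinuityZ3.Theorems.PercNearOneGluingNoHeavyLowerTailThreePartitionVOrderPrincipalBridge

/-!
# Conjecture W (kernel form of Conjecture V) on PRINCIPAL up-sets: `vSumTZ ∅ Z {(a,b) : x₀ ⊆ a, y₀ ⊆ b} ≥ 0` for every monotone
# 2-increasing weight `Z` (THEOREM P⊗)

Support file (lineage `prim-bnk-2`, generation 33; `--supports stmt-CriticalPhenomena-4575`; memo
`run/shared/lean/prim/prim-l12/FROM-prim-bnk-2-g33-CONJ-W.md` §3).  No `sorry`, no new definitions, standard axioms.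

`…ThreePartitionVOrderPrincipal` (THEOREM P) proves the principal case of Conjecture V for product weights `b ⊗ c`; the proof only
uses the kernel through quantities that are LINEAR in `b(S)c(T)`, so it runs verbatim for an arbitrary bivariate weight `Z(S,T)`:
`K_Z(x,y,z) = 2Z(x,x) + Z(z,y) − Z(z,x) − Z(x,z) − Z(z,z) = α_Z + β_Z`, `α_Z = Z(x,x) − Z(z,z)`,
`β_Z = Z(x,x) − Z(x,z) − Z(z,x) + Z(z,y)`, with the termwise slicing identities (`Z_{αβ}(S,T) := Z(S ∪ αe, T ∪ βe)`)
  `Σ_{e∈g,h,w} α_Z = α_{Z₁₁} + 2α_Z`,   `Σ_{e∈g,h,w} β_Z = β_Z + β_{Z₀₁} + β_{Z₁₀} + (Z₁₁ − Z₁₀ − Z₀₁ + Z₀₀)(x₀∪g, x₀∪g)`.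
Monotonicity of `Z` in each argument gives the `α`-part and the base case, 2-increasingness gives the square term; nonnegativity of
`Z` is not even needed.  Consequence (`vSumTZ_empty_nonneg_of_principal`): the principal case (τ = ∅) of `VOrderKernelPositivity`
(file `…ThreePartitionVOrderKernel`), i.e. by LP duality the coefficient matrix of a principal up-set lies in the cone `USN ⊗ USN`. [this work]
-/

namespace Summit.CriticalPhenomena.PercolationContinuityZ3.Theorems.ThreePartition

open Finset

section FinsetForm

variable {ι : Type*} [DecidableEq ι]

/-- **`α`-part for a bivariate weight.**  For `Z` monotone in each argument and any `x₀`: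
`Σ_{(g,h,w) ⊢ z₀} (Z(x₀∪g, x₀∪g) − Z(w,w)) ≥ 0`. [this work] -/
theorem principal_alphaZ_sum_nonneg (z₀ : Finset ι) :
    ∀ (Z : Finset ι → Finset ι → ℤ), (∀ S S' T, S ⊆ S' → Z S T ≤ Z S' T) → (∀ S T T', T ⊆ T' → Z S T ≤ Z S T') →
      ∀ (x₀ : Finset ι),
      0 ≤ ∑ g ∈ z₀.powerset, ∑ h ∈ (z₀ \ g).powerset, (Z (x₀ ∪ g) (x₀ ∪ g) - Z ((z₀ \ g) \ h) ((z₀ \ g) \ h)) := by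
  induction z₀ using Finset.induction_on with
  | empty =>
    intro Z hl hr x₀
    simp only [Finset.powerset_empty, Finset.sum_singleton, Finset.empty_sdiff, Finset.union_empty]
    have h1 : Z ∅ ∅ ≤ Z x₀ ∅ := hl _ _ _ (Finset.empty_subset _)
    have h2 : Z x₀ ∅ ≤ Z x₀ x₀ := hr _ _ _ (Finset.empty_subset _)
    linarith
  | insert e z₀ he ih =>
    intro Z hl hr x₀
    have h3 := sum_threePartitions_insert he (fun g h w => Z (x₀ ∪ g) (x₀ ∪ g) - Z w w)
    rw [h3]
    have hl1 : ∀ S S' T : Finset ι, S ⊆ S' → Z (insert e S) (insert e T) ≤ Z (insert e S') (insert e T) :=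
      fun S S' T hST => hl _ _ _ (Finset.insert_subset_insert e hST)
    have hr1 : ∀ S T T' : Finset ι, T ⊆ T' → Z (insert e S) (insert e T) ≤ Z (insert e S) (insert e T') :=
      fun S T T' hT => hr _ _ _ (Finset.insert_subset_insert e hT)
    have key := ih (fun S T => Z (insert e S) (insert e T)) hl1 hr1 x₀
    have key2 := ih Z hl hr x₀
    have hsplit : ∑ g ∈ z₀.powerset, ∑ h ∈ (z₀ \ g).powerset,
        (Z (x₀ ∪ insert e g) (x₀ ∪ insert e g) - Z ((z₀ \ g) \ h) ((z₀ \ g) \ h) +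
          (Z (x₀ ∪ g) (x₀ ∪ g) - Z ((z₀ \ g) \ h) ((z₀ \ g) \ h)) +
          (Z (x₀ ∪ g) (x₀ ∪ g) - Z (insert e ((z₀ \ g) \ h)) (insert e ((z₀ \ g) \ h)))) =
        (∑ g ∈ z₀.powerset, ∑ h ∈ (z₀ \ g).powerset,
          (Z (insert e (x₀ ∪ g)) (insert e (x₀ ∪ g)) - Z (insert e ((z₀ \ g) \ h)) (insert e ((z₀ \ g) \ h)))) +
        2 * ∑ g ∈ z₀.powerset, ∑ h ∈ (z₀ \ g).powerset,
          (Z (x₀ ∪ g) (x₀ ∪ g) - Z ((z₀ \ g) \ h) ((z₀ \ g) \ h)) := by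
      rw [Finset.mul_sum, ← Finset.sum_add_distrib]
      refine Finset.sum_congr rfl fun g _ => ?_
      rw [Finset.mul_sum, ← Finset.sum_add_distrib]
      refine Finset.sum_congr rfl fun h _ => ?_
      rw [Finset.union_insert]
      ring
    rw [hsplit]
    nlinarith [key, key2]

/-- **`β`-part for a bivariate weight.**  For `Z` monotone in each argument and 2-increasing, and any `x₀, y₀`:
`Σ_{(g,h,w) ⊢ z₀} (Z(x₀∪g,x₀∪g) − Z(x₀∪g,w) − Z(w,x₀∪g) + Z(w,y₀∪h)) ≥ 0`. [this work] -/
theorem principal_betaZ_sum_nonneg (z₀ : Finset ι) :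
    ∀ (Z : Finset ι → Finset ι → ℤ), (∀ S S' T, S ⊆ S' → Z S T ≤ Z S' T) → (∀ S T T', T ⊆ T' → Z S T ≤ Z S T') →
      (∀ S S' T T', S ⊆ S' → T ⊆ T' → Z S' T + Z S T' ≤ Z S' T' + Z S T) → ∀ (x₀ y₀ : Finset ι),
      0 ≤ ∑ g ∈ z₀.powerset, ∑ h ∈ (z₀ \ g).powerset,
        (Z (x₀ ∪ g) (x₀ ∪ g) - Z (x₀ ∪ g) ((z₀ \ g) \ h) - Z ((z₀ \ g) \ h) (x₀ ∪ g) + Z ((z₀ \ g) \ h) (y₀ ∪ h)) := by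
  induction z₀ using Finset.induction_on with
  | empty =>
    intro Z hl hr hm x₀ y₀
    simp only [Finset.powerset_empty, Finset.sum_singleton, Finset.empty_sdiff, Finset.union_empty]
    have h1 := hm ∅ x₀ ∅ x₀ (Finset.empty_subset _) (Finset.empty_subset _)
    have h2 : Z ∅ ∅ ≤ Z ∅ y₀ := hr _ _ _ (Finset.empty_subset _)
    linarith
  | insert e z₀ he ih =>
    intro Z hl hr hm x₀ y₀
    have h3 := sum_threePartitions_insert he
      (fun g h w => Z (x₀ ∪ g) (x₀ ∪ g) - Z (x₀ ∪ g) w - Z w (x₀ ∪ g) + Z w (y₀ ∪ h))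
    rw [h3]
    -- the three shifted weights inherit the hypotheses
    have hl01 : ∀ S S' T : Finset ι, S ⊆ S' → Z S (insert e T) ≤ Z S' (insert e T) := fun S S' T hST => hl _ _ _ hST
    have hr01 : ∀ S T T' : Finset ι, T ⊆ T' → Z S (insert e T) ≤ Z S (insert e T') :=
      fun S T T' hT => hr _ _ _ (Finset.insert_subset_insert e hT)
    have hm01 : ∀ S S' T T' : Finset ι, S ⊆ S' → T ⊆ T' →
        Z S' (insert e T) + Z S (insert e T') ≤ Z S' (insert e T') + Z S (insert e T) :=
      fun S S' T T' hS hT => hm _ _ _ _ hS (Finset.insert_subset_insert e hT)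
    have hl10 : ∀ S S' T : Finset ι, S ⊆ S' → Z (insert e S) T ≤ Z (insert e S') T :=
      fun S S' T hST => hl _ _ _ (Finset.insert_subset_insert e hST)
    have hr10 : ∀ S T T' : Finset ι, T ⊆ T' → Z (insert e S) T ≤ Z (insert e S) T' := fun S T T' hT => hr _ _ _ hT
    have hm10 : ∀ S S' T T' : Finset ι, S ⊆ S' → T ⊆ T' →
        Z (insert e S') T + Z (insert e S) T' ≤ Z (insert e S') T' + Z (insert e S) T :=
      fun S S' T T' hS hT => hm _ _ _ _ (Finset.insert_subset_insert e hS) hT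
    have k00 := ih Z hl hr hm x₀ y₀
    have k01 := ih (fun S T => Z S (insert e T)) hl01 hr01 hm01 x₀ y₀
    have k10 := ih (fun S T => Z (insert e S) T) hl10 hr10 hm10 x₀ y₀
    -- the square term (mixed second difference) is termwise nonnegative
    have ksq : 0 ≤ ∑ g ∈ z₀.powerset, ∑ h ∈ (z₀ \ g).powerset,
        (Z (insert e (x₀ ∪ g)) (insert e (x₀ ∪ g)) - Z (insert e (x₀ ∪ g)) (x₀ ∪ g)
          - Z (x₀ ∪ g) (insert e (x₀ ∪ g)) + Z (x₀ ∪ g) (x₀ ∪ g)) := by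
      refine Finset.sum_nonneg fun g _ => Finset.sum_nonneg fun h _ => ?_
      have := hm (x₀ ∪ g) (insert e (x₀ ∪ g)) (x₀ ∪ g) (insert e (x₀ ∪ g)) (Finset.subset_insert e _)
        (Finset.subset_insert e _)
      linarith
    -- termwise slicing identity
    have hsplit : ∑ g ∈ z₀.powerset, ∑ h ∈ (z₀ \ g).powerset,
        ((Z (x₀ ∪ insert e g) (x₀ ∪ insert e g) - Z (x₀ ∪ insert e g) ((z₀ \ g) \ h)
            - Z ((z₀ \ g) \ h) (x₀ ∪ insert e g) + Z ((z₀ \ g) \ h) (y₀ ∪ h)) +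
          (Z (x₀ ∪ g) (x₀ ∪ g) - Z (x₀ ∪ g) ((z₀ \ g) \ h) - Z ((z₀ \ g) \ h) (x₀ ∪ g)
            + Z ((z₀ \ g) \ h) (y₀ ∪ insert e h)) +
          (Z (x₀ ∪ g) (x₀ ∪ g) - Z (x₀ ∪ g) (insert e ((z₀ \ g) \ h)) - Z (insert e ((z₀ \ g) \ h)) (x₀ ∪ g)
            + Z (insert e ((z₀ \ g) \ h)) (y₀ ∪ h))) =
        (∑ g ∈ z₀.powerset, ∑ h ∈ (z₀ \ g).powerset,
          (Z (x₀ ∪ g) (x₀ ∪ g) - Z (x₀ ∪ g) ((z₀ \ g) \ h) - Z ((z₀ \ g) \ h) (x₀ ∪ g) + Z ((z₀ \ g) \ h) (y₀ ∪ h))) +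
        (∑ g ∈ z₀.powerset, ∑ h ∈ (z₀ \ g).powerset,
          (Z (x₀ ∪ g) (insert e (x₀ ∪ g)) - Z (x₀ ∪ g) (insert e ((z₀ \ g) \ h))
            - Z ((z₀ \ g) \ h) (insert e (x₀ ∪ g)) + Z ((z₀ \ g) \ h) (insert e (y₀ ∪ h)))) +
        (∑ g ∈ z₀.powerset, ∑ h ∈ (z₀ \ g).powerset,
          (Z (insert e (x₀ ∪ g)) (x₀ ∪ g) - Z (insert e (x₀ ∪ g)) ((z₀ \ g) \ h)
            - Z (insert e ((z₀ \ g) \ h)) (x₀ ∪ g) + Z (insert e ((z₀ \ g) \ h)) (y₀ ∪ h))) +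
        ∑ g ∈ z₀.powerset, ∑ h ∈ (z₀ \ g).powerset,
          (Z (insert e (x₀ ∪ g)) (insert e (x₀ ∪ g)) - Z (insert e (x₀ ∪ g)) (x₀ ∪ g)
            - Z (x₀ ∪ g) (insert e (x₀ ∪ g)) + Z (x₀ ∪ g) (x₀ ∪ g)) := by
      rw [← Finset.sum_add_distrib, ← Finset.sum_add_distrib, ← Finset.sum_add_distrib]
      refine Finset.sum_congr rfl fun g _ => ?_
      rw [← Finset.sum_add_distrib, ← Finset.sum_add_distrib, ← Finset.sum_add_distrib]
      refine Finset.sum_congr rfl fun h _ => ?_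
      rw [Finset.union_insert, Finset.union_insert]
      ring
    rw [hsplit]
    nlinarith [k00, k01, k10, ksq]

/-- **THEOREM P⊗ (finset form).**  For `Z : Finset ι → Finset ι → ℤ` monotone in each argument and 2-increasing
(`Z(S',T) + Z(S,T') ≤ Z(S',T') + Z(S,T)` for `S ⊆ S'`, `T ⊆ T'`), and any `x₀, y₀, z₀`:
`Σ_{(g,h,w) ⊢ z₀} (2Z(x₀∪g,x₀∪g) + Z(w,y₀∪h) − Z(w,x₀∪g) − Z(x₀∪g,w) − Z(w,w)) ≥ 0`. [this work] -/
theorem principal_kernelZ_sum_nonneg (Z : Finset ι → Finset ι → ℤ)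
    (hl : ∀ S S' T, S ⊆ S' → Z S T ≤ Z S' T) (hr : ∀ S T T', T ⊆ T' → Z S T ≤ Z S T')
    (hm : ∀ S S' T T', S ⊆ S' → T ⊆ T' → Z S' T + Z S T' ≤ Z S' T' + Z S T) (x₀ y₀ z₀ : Finset ι) :
    0 ≤ ∑ g ∈ z₀.powerset, ∑ h ∈ (z₀ \ g).powerset,
      (2 * Z (x₀ ∪ g) (x₀ ∪ g) + Z ((z₀ \ g) \ h) (y₀ ∪ h) - Z ((z₀ \ g) \ h) (x₀ ∪ g)
        - Z (x₀ ∪ g) ((z₀ \ g) \ h) - Z ((z₀ \ g) \ h) ((z₀ \ g) \ h)) := by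
  have hA := principal_alphaZ_sum_nonneg z₀ Z hl hr x₀
  have hB := principal_betaZ_sum_nonneg z₀ Z hl hr hm x₀ y₀
  have hsplit : ∑ g ∈ z₀.powerset, ∑ h ∈ (z₀ \ g).powerset,
      (2 * Z (x₀ ∪ g) (x₀ ∪ g) + Z ((z₀ \ g) \ h) (y₀ ∪ h) - Z ((z₀ \ g) \ h) (x₀ ∪ g)
        - Z (x₀ ∪ g) ((z₀ \ g) \ h) - Z ((z₀ \ g) \ h) ((z₀ \ g) \ h)) =
      (∑ g ∈ z₀.powerset, ∑ h ∈ (z₀ \ g).powerset, (Z (x₀ ∪ g) (x₀ ∪ g) - Z ((z₀ \ g) \ h) ((z₀ \ g) \ h))) +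
      ∑ g ∈ z₀.powerset, ∑ h ∈ (z₀ \ g).powerset,
        (Z (x₀ ∪ g) (x₀ ∪ g) - Z (x₀ ∪ g) ((z₀ \ g) \ h) - Z ((z₀ \ g) \ h) (x₀ ∪ g) + Z ((z₀ \ g) \ h) (y₀ ∪ h)) := by
    rw [← Finset.sum_add_distrib]
    refine Finset.sum_congr rfl fun g _ => ?_
    rw [← Finset.sum_add_distrib]
    refine Finset.sum_congr rfl fun h _ => ?_
    ring
  rw [hsplit]
  exact add_nonneg hA hB

end FinsetForm

/-! ## The principal case of `VOrderKernelPositivity` (τ = ∅) -/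

section SetForm

open scoped symmDiff Classical

variable {ι : Type*} [Fintype ι]

/-- **THEOREM P⊗ (Conjecture-W form).**  For every weight `Z : Set ι → Set ι → ℤ` that is monotone in each argument and
2-increasing, and all `x₀, y₀`, the untwisted weighted kernel sum over the principal up-set `{(a,b) : x₀ ⊆ a, y₀ ⊆ b}` of the copy
order is nonnegative: `vSumTZ ∅ Z {(a,b) : x₀ ⊆ a, y₀ ⊆ b} ≥ 0` — the principal case of `VOrderKernelPositivity`; by LP duality,
the coefficient matrix of every principal up-set lies in the cone `USN ⊗ USN`. [this work] -/
theorem vSumTZ_empty_nonneg_of_principal (Z : Set ι → Set ι → ℤ)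
    (hl : ∀ (S S' T : Set ι), S ⊆ S' → Z S T ≤ Z S' T) (hr : ∀ (S T T' : Set ι), T ⊆ T' → Z S T ≤ Z S T')
    (hm : ∀ (S S' T T' : Set ι), S ⊆ S' → T ⊆ T' → Z S' T + Z S T' ≤ Z S' T' + Z S T) (x₀ y₀ : Finset ι) :
    0 ≤ vSumTZ ∅ Z {q : Set ι × Set ι | (↑x₀ : Set ι) ⊆ q.1 ∧ (↑y₀ : Set ι) ⊆ q.2} := by
  by_cases hxy : Disjoint x₀ y₀
  · rw [vSumTZ_empty_principal_eq Z x₀ y₀ hxy]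
    have key := principal_kernelZ_sum_nonneg (fun S T : Finset ι => Z ↑S ↑T)
      (fun S S' T hST => hl _ _ _ (Finset.coe_subset.2 hST)) (fun S T T' hT => hr _ _ _ (Finset.coe_subset.2 hT))
      (fun S S' T T' hS hT => hm _ _ _ _ (Finset.coe_subset.2 hS) (Finset.coe_subset.2 hT)) x₀ y₀ (x₀ ∪ y₀)ᶜ
    exact key
  · have hempty : facesIn ∅ {q : Set ι × Set ι | (↑x₀ : Set ι) ⊆ q.1 ∧ (↑y₀ : Set ι) ⊆ q.2} = ∅ := by
      rw [Finset.eq_empty_iff_forall_notMem]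
      intro q hq
      rw [mem_facesIn_iff] at hq
      obtain ⟨hdis, hmem⟩ := hq
      simp only [set_symmDiff_empty, Set.mem_setOf_eq] at hmem
      apply hxy
      rw [Finset.disjoint_left]
      intro i hix hiy
      exact Set.disjoint_left.1 hdis (hmem.1 (Finset.mem_coe.2 hix)) (hmem.2 (Finset.mem_coe.2 hiy))
    unfold vSumTZ
    rw [hempty, Finset.sum_empty]

end SetForm

end Summit.CriticalPhenomena.PercolationContinuityZ3.Theorems.ThreePartition
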